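import Literature.MathematicalPhysics.QuantumFieldTheory.Balaban1983to89.B9Thm39ReadingAtLetters
import Literature.MathematicalPhysics.QuantumFieldTheory.Balaban1983to89.B9Ineq349SiteFromConv342

/-!
# `Balaban1983to89.B9Ineq349SiteFromConv348` — T. Bałaban, *Propagators for lattice gauge theories in a background field*, Commun. Math. Phys. **99**
# (1985) 389–434 [Balaban1985BackgroundPropagators], (3.49) p. 399 ⇐ Thm 3.2 (3.48) p. 398 ⇐ Thm 3.9 p. 413: ROW 25's Thm-3.2 INPUT `Blk348At` ∕
# `Thm32BlkSchema` DERIVED from a Theorem-3.9-shape block majorant of `(Q′G′²Q′*)(U)⁻¹` (n06-j's letter `L39`, `B9Thm39WholeBlk.Conv348Blk`) taken at a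
# LEVEL-∕1-FAITHFUL representative `rep39F` read off the knit's bond map `bI` — the consumer half; with the sibling `B9Ineq349SiteFromConv342` ROW 25
# follows from the Thm-3.7 and Thm-3.9 majorants with NO (3.42)∕(3.48) schema displayed

[4] = T. Bałaban, *Propagators and renormalization transformations for lattice gauge theories. II*, Commun. Math. Phys. **96** (1984) 223–250
[`Balaban1984PropagatorsII`].

statement-level skeleton of published theorems with citation tags; proofs where landed; nothing here is a claim about the Yang–Mills mass gap

THE PRINT.  p. 398 (3.48): *«|(Q′(U)G′²(U)Q′*(U))⁻¹(y, y′)| ≦ B₀(Lʲη)⁻⁴(L^{j′}η)^{−d}e^{−δ₀d(y,y′)}, y, y′ ∈ 𝔅»*; p. 413: *«This theorem [3.9] implies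
Theorem 3.2»*; p. 399: *«… using again Lemma 2.1, (3.49)»*.
WHY THIS FILE (dag-n06-i gen 11, N06 bundle F4, row 25; successor of `B9Ineq349SiteFromConv342`).  After the sibling, row 25 needs only `h32B :
Thm32BlkSchema …` — (3.48) for the genuine `C(U) = CY parS G′ U` at EVERY block pair.  Rows 15–16 of the knit (n06-j `B9Thm39ReadingAtLetters`) carry
Theorem 3.9's convergence as `Conv348Blk (𝔬39 x) B₁ δ₁ U`: a block majorant `B₁(Lʲη)⁻⁴e^{−δ₁d}` of a two-sided inverse of `L39 parS G′ U` (the genuine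
`(Q′G′²Q′*)(U)`, print's units, real coordinates on `X39 = 𝔅 × κ39`) w.r.t. `blk39 = rep39 ∘ fst`, where `rep39` sends a block OUTSIDE the range of `β`
(inner corners) to an ARBITRARY bond (`Classical.choice`) — there the majorant measures length and distance at an unrelated bond and cannot feed (3.49)'s
middle sum over ALL block pairs.  THIS FILE builds the FAITHFUL representative from the knit's bond map `bI` (`rep39F i bI s := sIK i bI (corner of s)`:
right level by `hlev`, within `d_T ≤ 1` of `s` by `hβ1`, `β ∘ rep ∘ β = β` by `hβI` — the one property n06-j's reading uses) and proves the consumer half.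

WHAT IS PROVED (sorry-free; finite-dimensional linear algebra and the record's bookkeeping; no estimate of the paper).
* §1 `rep39F`, `blk39F`, `blkOf_blkCornerY`, `lvl_rep39F`, `distB_beta_rep39F_le_one`, ★ `beta_rep39F_beta`, `len_rep39F`, `exp_dist_rep39F_le`.
* §2 `abs_entry_le_of_hasMajorant`, `cWtY_mul_unit39` (every block: `cWtY s′ · unit39 = ((lenB s′)^{d+1})⁻¹`), ★ `norm_CY_deltaY_le_of_inverse` (n06-j's
  `reading_le_of_letters` dictionary at an ARBITRARY block pair: `‖C(U)(δ_{s′}⊗F)(s)‖ ≤ ((lenB s′)^{d+1})⁻¹ · cR39 · |κ39| · K (rep s) (rep s′)`).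
* §3 ★★ `blk348At_of_hasMajorant` — `HasMajorant (blk39F i bI) T (B₁·len^{−4}·e^{−δ₁d})`, `bI` level-∕1-faithful ⟹ `Blk348At … (cR39·|κ39|·B₁·e^{2δ₁}) δ₁`;
  `blk348At_mono`.
* §4 ★ `thm32BlkSchema_of_majorants` (family level, any finite-dimensional `𝔸`, any `G`), ★ `majorants348_of_thm39Printed` (the leaf `B9.Thm39Printed … EK`
  with `(EK x).Converges U → Conv348Blk (𝔬39 x) B₁ δ₁ U` and the pins `hblk39`, `hL39` ⟹ the majorant hypothesis), ★★★
  `stmt349Printed_site_lettersYOfRecordV4_of_majorants37_39` = ROW 25 at the v4 record from the Thm-3.7 majorants (row 18) AND the Thm-3.9 majorant at the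
  faithful block pins + `hlev` + `hβ1` + `hnbr` — no (3.42)∕(3.48) schema among the inputs.

HONEST SCOPE.  Consumer half only: usable by the knit iff rows 15–16 are pinned on `blk39F` (n06-j's `B9Thm39ReadingAtLetters` §5 with `rep39 ↦ rep39F`,
threading `bI hβI`; their proofs use only `β ∘ rep ∘ β = β` = `beta_rep39F_beta`); nothing of [B9]∕[4] asserted; count-neutral; N06 NOT discharged; nothing
continuum ∕ OS ∕ mass gap.  Cell `pub-ymgap` (D-0062), node N06 [B9], seat `pub-ymgap-dag-n06-i` (gen 11), 2026-08-27; a NEW file, nothing landed is modified.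
-/

noncomputable section

namespace Literature.MathematicalPhysics.QuantumFieldTheory.Balaban1983to89.B9Ineq349SiteFromConv348

open B6RandomWalk (HasMajorant BlockSupp)
open B9Thm34Inv (entry)
open B9Thm34Ext (toB6)
open B9Thm39WholeBlk (Ops39Blk Conv348Blk b6)
open B9Thm39ReadingCoords (coordEquiv39 realify39 realify39_apply realify39_mul realify39_one entry_realify39 norm_apply_deltaY_le cR39 cR39_nonneg
  coordBound39 basisBound39)
open B9Thm39ReadingAtLetters (κ39 basis39 X39 unit39 unit39_pos cWtY_pos L39 CY_deltaY_apply)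
open B6Geom246MultiLevelBox (blkOf blkOf_corner)
open B6GlobalChartV1 (blkV1)
open B6Ineq2142KLevelV1 (lvl β)
open B6Ineq268MultiLevelBox (W W_pos W_eq)
open B6Prop22KLevelTorusCensusEta (nKT nKT_pos)
open B9CoReadingCoordsS (sIK sIK_level sIK_faithful)
open B9CoordSliceMajorant (len_sIK_eq_lenB distB_sIK_le_one exp_dist_sIK_le)
open B9Ineq349SiteReading (p349SiteY)
open B9Ineq349SiteComposite (lenB distB lenB_eq lenB_pos distB_nonneg etaS_pos Blk348At)
open B9Ineq349SiteFromBlocks (Thm32BlkSchema etaS_eq_abs_cf_inv)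
open B9Ineq349SiteFromConv342 (stmt349Printed_site_lettersYOfRecordV4_of_majorants)
open B9CoReadingCoordsS (XSK blkSK GcoS DcoS)
open B6RandomWalkHom (HasMajorantHom)
open B7Prop2SpecialUnitary (specialUnitaryUnits)
open B9PinMembersKLevelV1 (MemberY geo9Y bg9Y)
open B9GeoLemma21KLevelV1 (geo9Y_len_pos)
open B9RWSumsReadsNbr (nbr)
open Node00

variable {𝔸 : Type} [NormedRing 𝔸] [NormedAlgebra ℂ 𝔸] [CompleteSpace 𝔸]
variable {d ℓ : ℕ} {hd : 1 ≤ d + 1} {hL : Odd (ℓ + 1) ∧ 1 < ℓ + 1} {b₀ b₁ : ℝ} {Mstar : ℕ}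

/-! ## §1 The FAITHFUL representative bond of a block, read off the knit's bond map `bI` -/

section Rep

variable (i : B6KLevelCensusIndexV1.KIdx d ℓ hd hL b₀ b₁) (bI : FBondY i → IBondY i)

/-- ★ **THE FAITHFUL REPRESENTATIVE BOND OF A BLOCK**: the index bond the knit's bond map `bI` assigns to the fine bond leaving the block's corner in direction
`0`; for a faithful `bI` (n06-k `B9IndexBondFaithful`): right level, based within `d_T ≤ 1` of `s`, AT `s` when `s` is a carrier block. [cite: Balaban1984PropagatorsII, (2.45) p.231 + p.248, dictionary] -/
def rep39F (s : BlkY i) : IBondY i := sIK i bI (blkCornerY i s)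

variable (𝔸) in
/-- the block map of the carrier `X39 = 𝔅 × κ39` through the faithful representative (the faithful twin of n06-j's `blk39`). [cite: Balaban1984PropagatorsII, p.248 + (2.45) p.231, dictionary] -/
def blk39F : X39 𝔸 i → IBondY i := fun p => rep39F i bI p.1

/-- the corner site of a block lies in the block. [cite: Balaban1984PropagatorsII, (2.45) p.231, bookkeeping] -/
theorem blkOf_blkCornerY (s : BlkY i) : blkOf i.D.toDomains (blkCornerY i s) = s := blkOf_corner i.D.toDomains s

variable {i bI}

/-- **level-faithful**: `lvl (rep39F s) = j(s)`. [cite: Balaban1985BackgroundPropagators, (3.41) p.397, bookkeeping] -/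
theorem lvl_rep39F (hlev : ∀ f : FBondY i, lvl i.hN i.D i.hk (bI f) = (blkV1 i.hN i.D f).1.1) (s : BlkY i) :
    lvl i.hN i.D i.hk (rep39F i bI s) = s.1.1 := by
  rw [rep39F, sIK_level i hlev, blkOf_blkCornerY]

/-- ★ **`β ∘ rep39F ∘ β = β`** for a carrier-faithful `bI` — the one property of a representative that n06-j's reading (`B9Thm39ReadingAtLetters`) uses.
[cite: Balaban1984PropagatorsII, (2.45) p.231, bookkeeping] -/
theorem beta_rep39F_beta (hβI : ∀ (f : FBondY i) (c : IBondY i), blkV1 i.hN i.D f = β i.hN i.D i.hk c → β i.hN i.D i.hk (bI f) = blkV1 i.hN i.D f)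
    (c : IBondY i) : β i.hN i.D i.hk (rep39F i bI (β i.hN i.D i.hk c)) = β i.hN i.D i.hk c := by
  rw [rep39F, sIK_faithful i hβI (blkCornerY i (β i.hN i.D i.hk c)) c (blkOf_blkCornerY i _), blkOf_blkCornerY]

variable (x : MemberY d ℓ hd hL b₀ b₁ Mstar) {bI : FBondY x.toKIdx → IBondY x.toKIdx}

/-- **1-faithful**: `d_T(β(rep39F s), s) ≤ 1`. [cite: Balaban1984PropagatorsII, (2.46) p.231, bookkeeping] -/
theorem distB_beta_rep39F_le_one
    (hβ1 : ∀ f : FBondY x.toKIdx, (B6Geom246MultiLevelTorus.geomT x.D).dist (β x.hN x.D x.hk (bI f)) (blkV1 x.hN x.D f) ≤ 1) (s : BlkY x.toKIdx) :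
    distB x.toKIdx (β x.hN x.D x.hk (rep39F x.toKIdx bI s)) s ≤ 1 := by
  have h := distB_sIK_le_one x hβ1 (blkCornerY x.toKIdx s)
  rwa [blkOf_blkCornerY] at h

/-- ★ **the model length at the faithful representative IS print's `Lʲη` of the block**. [cite: Balaban1985BackgroundPropagators, (3.41) p.397, bookkeeping] -/
theorem len_rep39F (hlev : ∀ f : FBondY x.toKIdx, lvl x.hN x.D x.hk (bI f) = (blkV1 x.hN x.D f).1.1) (s : BlkY x.toKIdx) :
    (geo9Y x).len (rep39F x.toKIdx bI s) = lenB x.toKIdx s := by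
  have h := len_sIK_eq_lenB x hlev (blkCornerY x.toKIdx s)
  rwa [blkOf_blkCornerY] at h

/-- at the faithful representatives: `e^{−δ d(rep s, rep s′)} ≤ e^{2δ}·e^{−δ d_T(s, s′)}` (`δ ≥ 0`). [cite: Balaban1984PropagatorsII, (2.54) p.233, bookkeeping] -/
theorem exp_dist_rep39F_le (hβ1 : ∀ f : FBondY x.toKIdx, (B6Geom246MultiLevelTorus.geomT x.D).dist (β x.hN x.D x.hk (bI f)) (blkV1 x.hN x.D f) ≤ 1)
    {δ : ℝ} (hδ : 0 ≤ δ) (s s' : BlkY x.toKIdx) :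
    Real.exp (-(δ * (geo9Y x).dist (rep39F x.toKIdx bI s) (rep39F x.toKIdx bI s'))) ≤ Real.exp (2 * δ) * Real.exp (-(δ * distB x.toKIdx s s')) := by
  have h := exp_dist_sIK_le x hβ1 hδ (blkCornerY x.toKIdx s) (blkCornerY x.toKIdx s')
  rwa [blkOf_blkCornerY, blkOf_blkCornerY] at h

end Rep

/-! ## §2 Entries under a block majorant; the weights; n06-j's dictionary at an arbitrary block pair -/

section Dictionary

variable {S κ' : Type} [Fintype S] [DecidableEq S] [Fintype κ'] [DecidableEq κ']

omit [Fintype S] [Fintype κ'] in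
/-- **an entry of a block-majorised operator is at most the majorant of its blocks** (test [4] (2.51) with `δ_{(s′,c′)}`). [cite: Balaban1984PropagatorsII, (2.51) p.232, bookkeeping] -/
theorem abs_entry_le_of_hasMajorant {g : B6.Geometry} (rep : S → g.Site) {T : Module.End ℝ (S × κ' → ℝ)} {K : g.Site → g.Site → ℝ}
    (hT : HasMajorant (g := g) (fun p : S × κ' => rep p.1) T K) (s : S) (c : κ') (s' : S) (c' : κ') :
    |entry T (s, c) (s', c')| ≤ K (rep s) (rep s') := by
  have hsupp : BlockSupp (g := g) (fun p : S × κ' => rep p.1) (Pi.single (s', c') (1 : ℝ) : S × κ' → ℝ) (rep s') 1 := by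
    refine ⟨zero_le_one, fun p _ => ?_, fun p hp => ?_⟩
    · by_cases h : p = (s', c')
      · subst h; simp
      · rw [Pi.single_eq_of_ne h]; simp
    · have h : p ≠ (s', c') := fun h => hp (by rw [h])
      exact Pi.single_eq_of_ne h _
  have h := hT (rep s') _ 1 hsupp (s, c)
  rw [mul_one] at h
  exact h

/-- **THE WEIGHTS IDENTITY AT EVERY BLOCK** (n06-j's `cWtY_beta_mul_unit39` off the range of `β`): `cWtY s′ · unit39 = ((lenB s′)^{d+1})⁻¹`. [cite: Balaban1985BackgroundPropagators, (3.48) p.398; Balaban1984PropagatorsII, (2.69) p.235] -/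
theorem cWtY_mul_unit39 (x : MemberY d ℓ hd hL b₀ b₁ Mstar) (s' : BlkY x.toKIdx) :
    cWtY x.toKIdx s' * unit39 x.toKIdx = (lenB x.toKIdx s' ^ (d + 1))⁻¹ := by
  have hn : (0 : ℝ) < ((nKT (toKT x.toKIdx) : ℕ) : ℝ) := nKT_pos (toKT x.toKIdx)
  have hcf : (0 : ℝ) < |x.cf| := abs_pos.2 x.hcf
  have hL0 : (0 : ℝ) < (ℓ : ℝ) + 1 := by positivity
  rw [cWtY, unit39, W_eq, lenB_eq, etaS_eq_abs_cf_inv, mul_pow, inv_pow, mul_inv, inv_inv]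
  field_simp

/-- `Ring.inverse (c • a) = c⁻¹ • Ring.inverse a` for a non-zero scalar. [folklore] -/
private theorem ring_inverse_smul {V : Type} [AddCommGroup V] [Module ℂ V] (c : ℂ) (hc : c ≠ 0) (a : Module.End ℂ V) :
    Ring.inverse (c • a) = c⁻¹ • Ring.inverse a := by
  by_cases ha : IsUnit a
  · have h1 : (c • a) * (c⁻¹ • Ring.inverse a) = 1 := by
      rw [smul_mul_assoc, mul_smul_comm, smul_smul, mul_inv_cancel₀ hc, one_smul, Ring.mul_inverse_cancel a ha]
    have h2 : (c⁻¹ • Ring.inverse a) * (c • a) = 1 := by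
      rw [smul_mul_assoc, mul_smul_comm, smul_smul, inv_mul_cancel₀ hc, one_smul, Ring.inverse_mul_cancel a ha]
    exact (Ring.inverse_unit ⟨c • a, c⁻¹ • Ring.inverse a, h1, h2⟩)
  · have hca : ¬ IsUnit (c • a) := by
      intro hu
      apply ha
      have h1 : (c⁻¹ • (c • a)) * (c • Ring.inverse (c • a)) = 1 := by
        rw [smul_mul_assoc, mul_smul_comm, smul_smul, inv_mul_cancel₀ hc, one_smul, Ring.mul_inverse_cancel _ hu]
      have h2 : (c • Ring.inverse (c • a)) * (c⁻¹ • (c • a)) = 1 := by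
        rw [smul_mul_assoc, mul_smul_comm, smul_smul, mul_inv_cancel₀ hc, one_smul, Ring.inverse_mul_cancel _ hu]
      have : c⁻¹ • (c • a) = a := by rw [smul_smul, inv_mul_cancel₀ hc, one_smul]
      rw [← this]
      exact ⟨⟨_, _, h1, h2⟩, rfl⟩
    rw [Ring.inverse_non_unit _ ha, Ring.inverse_non_unit _ hca, smul_zero]

variable [FiniteDimensional ℂ 𝔸]

/-- ★ **n06-j's (3.48) READING DICTIONARY AT AN ARBITRARY BLOCK PAIR**: a two-sided inverse `T` of `L39 parS G′ U` with `|entry T (s, c) (s′, c′)| ≤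
K (rep s) (rep s′)` gives `‖C(U)(δ_{s′}⊗F)(s)‖ ≤ ((lenB s′)^{d+1})⁻¹ · (cR39 · |κ39|) · K (rep s) (rep s′)` for `‖F‖ ≤ 1` (`T` is `(Q′G′²Q′*)⁻¹(U)` in coordinates,
`C(U) = cWtY •` it, `cWtY(s′)·unit39 = ((lenB s′)^{d+1})⁻¹`). [cite: Balaban1985BackgroundPropagators, Thm 3.2 (3.48) p.398 + (3.25) p.395 + (3.96) p.411; Balaban1984PropagatorsII, (2.51) p.232] -/
theorem norm_CY_deltaY_le_of_inverse (x : MemberY d ℓ hd hL b₀ b₁ Mstar) (parS : SiteParY 𝔸 x.toKIdx) (Gp : SiteOpY 𝔸 x.toKIdx) (U : CfgY 𝔸 x.toKIdx)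
    (T : Module.End ℝ (X39 𝔸 x.toKIdx → ℝ)) (hTL : T * L39 x.toKIdx parS Gp U = 1) (hLT : L39 x.toKIdx parS Gp U * T = 1)
    (rep : BlkY x.toKIdx → IBondY x.toKIdx) {K : IBondY x.toKIdx → IBondY x.toKIdx → ℝ}
    (hK : ∀ (s : BlkY x.toKIdx) (c : κ39 𝔸) (s' : BlkY x.toKIdx) (c' : κ39 𝔸), |entry T (s, c) (s', c')| ≤ K (rep s) (rep s'))
    (s s' : BlkY x.toKIdx) {F : 𝔸} (hF : ‖F‖ ≤ 1) :
    ‖CY x.toKIdx parS Gp U (deltaY s' F) s‖ ≤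
      (lenB x.toKIdx s' ^ (d + 1))⁻¹ * (cR39 (basis39 𝔸) * Fintype.card (κ39 𝔸)) * K (rep s) (rep s') := by
  classical
  set b := basis39 𝔸 with hb
  set u : ℂ := ((unit39 x.toKIdx : ℝ) : ℂ) with hu
  have hu0 : u ≠ 0 := by rw [hu]; exact_mod_cast (unit39_pos x.toKIdx).ne'
  set A : (BlkY x.toKIdx → 𝔸) →ₗ[ℂ] (BlkY x.toKIdx → 𝔸) := u • XY x.toKIdx parS Gp U with hA
  have hLU : L39 x.toKIdx parS Gp U = realify39 b A := rfl
  have hleft : ∀ f, T (realify39 b A f) = f := fun f => by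
    have := LinearMap.congr_fun hTL f
    rwa [Module.End.mul_apply, hLU, Module.End.one_apply] at this
  have hright : ∀ f, realify39 b A (T f) = f := fun f => by
    have := LinearMap.congr_fun hLT f
    rwa [Module.End.mul_apply, hLU, Module.End.one_apply] at this
  have hbijR : Function.Bijective (realify39 b A) := Function.bijective_iff_has_inverse.mpr ⟨T, hleft, hright⟩
  have hAeq : (A : (BlkY x.toKIdx → 𝔸) → (BlkY x.toKIdx → 𝔸)) = (coordEquiv39 b) ∘ (realify39 b A) ∘ (coordEquiv39 b).symm := by
    funext g
    simp only [Function.comp_apply, realify39_apply, LinearEquiv.apply_symm_apply]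
  have hbijA : Function.Bijective A := by
    rw [hAeq]
    exact (coordEquiv39 b).bijective.comp (hbijR.comp (coordEquiv39 b).symm.bijective)
  have hAunit : IsUnit A := (Module.End.isUnit_iff A).mpr hbijA
  have hT : T = realify39 b (Ring.inverse A) := by
    have e1 : realify39 b A * realify39 b (Ring.inverse A) = 1 := by
      rw [← realify39_mul, Ring.mul_inverse_cancel A hAunit, realify39_one]
    calc T = T * (realify39 b A * realify39 b (Ring.inverse A)) := by rw [e1, mul_one]
      _ = (T * L39 x.toKIdx parS Gp U) * realify39 b (Ring.inverse A) := by rw [mul_assoc, hLU]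
      _ = realify39 b (Ring.inverse A) := by rw [hTL, one_mul]
  have hXinv : XinvY x.toKIdx parS Gp U = u • Ring.inverse A := by
    rw [hA, ring_inverse_smul u hu0, smul_smul, mul_inv_cancel₀ hu0, one_smul]
    rfl
  -- the coordinate double sum of the entry is at most `|κ|²·K`
  have hsum : ∑ c : κ39 𝔸, ∑ c' : κ39 𝔸, |entry T (s, c) (s', c')| ≤ (Fintype.card (κ39 𝔸) : ℝ) * ((Fintype.card (κ39 𝔸) : ℝ) * K (rep s) (rep s')) := by
    calc ∑ c : κ39 𝔸, ∑ c' : κ39 𝔸, |entry T (s, c) (s', c')|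
        ≤ ∑ _c : κ39 𝔸, ∑ _c' : κ39 𝔸, K (rep s) (rep s') := Finset.sum_le_sum fun c _ => Finset.sum_le_sum fun c' _ => hK s c s' c'
      _ = (Fintype.card (κ39 𝔸) : ℝ) * ((Fintype.card (κ39 𝔸) : ℝ) * K (rep s) (rep s')) := by
          rw [Finset.sum_const, Finset.card_univ, nsmul_eq_mul, Finset.sum_const, Finset.card_univ, nsmul_eq_mul]
  have hw : 0 < cWtY x.toKIdx s' := cWtY_pos x.toKIdx _
  have hcbb : 0 ≤ coordBound39 b * basisBound39 b := mul_nonneg (norm_nonneg _) (Finset.sum_nonneg fun _ _ => norm_nonneg _)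
  have hO := norm_apply_deltaY_le b (Ring.inverse A) s s' hF
  rw [← hT] at hO
  rw [CY_deltaY_apply, hXinv, LinearMap.smul_apply, Pi.smul_apply, smul_smul, norm_smul]
  have hnorm : ‖((cWtY x.toKIdx s' : ℝ) : ℂ) * u‖ = cWtY x.toKIdx s' * unit39 x.toKIdx := by
    rw [hu, ← Complex.ofReal_mul, Complex.norm_real, Real.norm_eq_abs, abs_of_pos (mul_pos hw (unit39_pos x.toKIdx))]
  rw [hnorm, cWtY_mul_unit39]
  have hvol : 0 ≤ (lenB x.toKIdx s' ^ (d + 1))⁻¹ := inv_nonneg.2 (pow_nonneg (lenB_pos x.toKIdx s').le _)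
  calc (lenB x.toKIdx s' ^ (d + 1))⁻¹ * ‖(Ring.inverse A) (deltaY s' F) s‖
      ≤ (lenB x.toKIdx s' ^ (d + 1))⁻¹ * (coordBound39 b * basisBound39 b * ∑ c : κ39 𝔸, ∑ c' : κ39 𝔸, |entry T (s, c) (s', c')|) :=
        mul_le_mul_of_nonneg_left hO hvol
    _ ≤ (lenB x.toKIdx s' ^ (d + 1))⁻¹ * (coordBound39 b * basisBound39 b *
          ((Fintype.card (κ39 𝔸) : ℝ) * ((Fintype.card (κ39 𝔸) : ℝ) * K (rep s) (rep s')))) :=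
        mul_le_mul_of_nonneg_left (mul_le_mul_of_nonneg_left hsum hcbb) hvol
    _ = (lenB x.toKIdx s' ^ (d + 1))⁻¹ * (cR39 b * Fintype.card (κ39 𝔸)) * K (rep s) (rep s') := by rw [cR39]; ring

end Dictionary

/-! ## §3 ★★ `Blk348At` FROM THE BLOCK MAJORANT AT THE FAITHFUL PINS -/

section Blk

variable [FiniteDimensional ℂ 𝔸]

/-- ★★ **THE (3.48) SCHEMA OF (3.49) FROM THEOREM 3.9's BLOCK MAJORANT AT FAITHFUL PINS** (p. 413 «This theorem implies Theorem 3.2», block-completely):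
a two-sided inverse `T` of `L39 parS G′ U` with the [4]-(2.51) majorant `B₁(Lʲη)⁻⁴e^{−δ₁d}` w.r.t. `blk39F bI` (`bI` level-∕1-faithful; `B₁, δ₁ ≥ 0`) gives `Blk348At`
at EVERY block pair, constant `cR39·|κ39|·B₁·e^{2δ₁}`. [cite: Balaban1985BackgroundPropagators, Thm 3.2 (3.48) p.398 ⇐ Thm 3.9 pp.411–413; Balaban1984PropagatorsII, (2.51) p.232, (2.54) p.233] -/
theorem blk348At_of_hasMajorant (x : MemberY d ℓ hd hL b₀ b₁ Mstar) [Fintype (geo9Y x).Site] (parS : SiteParY 𝔸 x.toKIdx) (Gp : SiteOpY 𝔸 x.toKIdx)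
    (U : CfgY 𝔸 x.toKIdx) {bI : FBondY x.toKIdx → IBondY x.toKIdx}
    (hlev : ∀ f : FBondY x.toKIdx, lvl x.hN x.D x.hk (bI f) = (blkV1 x.hN x.D f).1.1)
    (hβ1 : ∀ f : FBondY x.toKIdx, (B6Geom246MultiLevelTorus.geomT x.D).dist (β x.hN x.D x.hk (bI f)) (blkV1 x.hN x.D f) ≤ 1)
    {R : ℝ} {H : Prop} {B₁ δ₁ : ℝ} (hB : 0 ≤ B₁) (hδ : 0 ≤ δ₁) (T : Module.End ℝ (X39 𝔸 x.toKIdx → ℝ))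
    (hTL : T * L39 x.toKIdx parS Gp U = 1) (hLT : L39 x.toKIdx parS Gp U * T = 1)
    (hmaj : HasMajorant (g := toB6 (geo9Y x) R H) (blk39F 𝔸 x.toKIdx bI) T
      (fun a a' => B₁ * (geo9Y x).len a ^ (-(4 : ℝ)) * Real.exp (-(δ₁ * (geo9Y x).dist a a')))) :
    Blk348At x.toKIdx parS Gp U (cR39 (basis39 𝔸) * Fintype.card (κ39 𝔸) * B₁ * Real.exp (2 * δ₁)) δ₁ := by
  intro s₁ s₂ F hF
  have hK : ∀ (s : BlkY x.toKIdx) (c : κ39 𝔸) (s' : BlkY x.toKIdx) (c' : κ39 𝔸), |entry T (s, c) (s', c')| ≤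
      B₁ * (geo9Y x).len (rep39F x.toKIdx bI s) ^ (-(4 : ℝ)) * Real.exp (-(δ₁ * (geo9Y x).dist (rep39F x.toKIdx bI s) (rep39F x.toKIdx bI s'))) :=
    fun s c s' c' => abs_entry_le_of_hasMajorant (g := toB6 (geo9Y x) R H) (rep39F x.toKIdx bI) hmaj s c s' c'
  have h := norm_CY_deltaY_le_of_inverse x parS Gp U T hTL hLT (rep39F x.toKIdx bI)
    (K := fun a a' => B₁ * (geo9Y x).len a ^ (-(4 : ℝ)) * Real.exp (-(δ₁ * (geo9Y x).dist a a'))) hK s₁ s₂ hF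
  rw [len_rep39F x hlev] at h
  have hc0 : 0 ≤ cR39 (basis39 𝔸) * Fintype.card (κ39 𝔸) := mul_nonneg (cR39_nonneg _) (Nat.cast_nonneg _)
  have hvol : (lenB x.toKIdx s₂ ^ (d + 1))⁻¹ = lenB x.toKIdx s₂ ^ (-((d + 1 : ℕ) : ℝ)) := by
    rw [Real.rpow_neg (lenB_pos x.toKIdx s₂).le, Real.rpow_natCast]
  have he := exp_dist_rep39F_le x hβ1 hδ s₁ s₂
  refine h.trans ?_
  rw [hvol]
  have h4 : 0 ≤ lenB x.toKIdx s₁ ^ (-(4 : ℝ)) := Real.rpow_nonneg (lenB_pos x.toKIdx s₁).le _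
  have hD : 0 ≤ lenB x.toKIdx s₂ ^ (-((d + 1 : ℕ) : ℝ)) := Real.rpow_nonneg (lenB_pos x.toKIdx s₂).le _
  calc lenB x.toKIdx s₂ ^ (-((d + 1 : ℕ) : ℝ)) * (cR39 (basis39 𝔸) * Fintype.card (κ39 𝔸)) *
        (B₁ * lenB x.toKIdx s₁ ^ (-(4 : ℝ)) * Real.exp (-(δ₁ * (geo9Y x).dist (rep39F x.toKIdx bI s₁) (rep39F x.toKIdx bI s₂))))
      ≤ lenB x.toKIdx s₂ ^ (-((d + 1 : ℕ) : ℝ)) * (cR39 (basis39 𝔸) * Fintype.card (κ39 𝔸)) *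
        (B₁ * lenB x.toKIdx s₁ ^ (-(4 : ℝ)) * (Real.exp (2 * δ₁) * Real.exp (-(δ₁ * distB x.toKIdx s₁ s₂)))) :=
        mul_le_mul_of_nonneg_left (mul_le_mul_of_nonneg_left he (mul_nonneg hB h4)) (mul_nonneg hD hc0)
    _ = cR39 (basis39 𝔸) * Fintype.card (κ39 𝔸) * B₁ * Real.exp (2 * δ₁) * lenB x.toKIdx s₁ ^ (-(4 : ℝ)) *
        lenB x.toKIdx s₂ ^ (-((d + 1 : ℕ) : ℝ)) * Real.exp (-(δ₁ * distB x.toKIdx s₁ s₂)) := by ring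

omit [FiniteDimensional ℂ 𝔸] in
/-- `Blk348At` is monotone in the constant `B₁`. [cite: Balaban1985BackgroundPropagators, Thm 3.2 (3.48) p.398, bookkeeping] -/
theorem blk348At_mono {i : B6KLevelCensusIndexV1.KIdx d ℓ hd hL b₀ b₁} {parS : SiteParY 𝔸 i} {Gp : SiteOpY 𝔸 i} {U : CfgY 𝔸 i} {B₁ B₁' δ₁ : ℝ}
    (h : Blk348At i parS Gp U B₁ δ₁) (hB : B₁ ≤ B₁') : Blk348At i parS Gp U B₁' δ₁ := by
  intro s₁ s₂ F hF
  refine (h s₁ s₂ F hF).trans ?_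
  have h1 : 0 ≤ lenB i s₁ ^ (-(4 : ℝ)) := Real.rpow_nonneg (lenB_pos i s₁).le _
  have h2 : 0 ≤ lenB i s₂ ^ (-((d + 1 : ℕ) : ℝ)) := Real.rpow_nonneg (lenB_pos i s₂).le _
  exact mul_le_mul_of_nonneg_right (mul_le_mul_of_nonneg_right (mul_le_mul_of_nonneg_right hB h1) h2) (Real.exp_nonneg _)

end Blk

/-! ## §4 The family statements: `Thm32BlkSchema` from the Thm-3.9 majorant at the faithful pins; ROW 25 with BOTH inputs derived -/

section Family

variable [FiniteDimensional ℂ 𝔸] {G : Subgroup 𝔸ˣ}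

/-- ★ **`Thm32BlkSchema` FROM THE BLOCK MAJORANTS AT THE FAITHFUL PINS** (any finite-dimensional `𝔸`, any `G`): under Theorem 3.9's printed prefix a two-sided
inverse of `L39 (𝔏 x).parS (𝔏 x).Gp U` with the majorant `B₁(Lʲη)⁻⁴e^{−δ₁d}` w.r.t. `blk39F (bI x)` gives `Thm32BlkSchema c35 𝔏`, `B₁′ = max(1, cR39·|κ39|·B₁·e^{2δ₁})`.
[cite: Balaban1985BackgroundPropagators, Thm 3.2 (3.48) p.398 ⇐ Thm 3.9 p.413; (3.35) p.396] -/
theorem thm32BlkSchema_of_majorants [∀ x : MemberY d ℓ hd hL b₀ b₁ Mstar, Fintype (geo9Y x).Site] {c35 : ℝ}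
    (𝔏 : ∀ x : MemberY d ℓ hd hL b₀ b₁ Mstar, CovLettersY 𝔸 x) {bI : ∀ x : MemberY d ℓ hd hL b₀ b₁ Mstar, FBondY x.toKIdx → IBondY x.toKIdx}
    (hlev : ∀ (x : MemberY d ℓ hd hL b₀ b₁ Mstar) (f : FBondY x.toKIdx), lvl x.hN x.D x.hk (bI x f) = (blkV1 x.hN x.D f).1.1)
    (hβ1 : ∀ (x : MemberY d ℓ hd hL b₀ b₁ Mstar) (f : FBondY x.toKIdx), (B6Geom246MultiLevelTorus.geomT x.D).dist (β x.hN x.D x.hk (bI x f)) (blkV1 x.hN x.D f) ≤ 1)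
    {R : MemberY d ℓ hd hL b₀ b₁ Mstar → ℝ} {H : MemberY d ℓ hd hL b₀ b₁ Mstar → Prop}
    (h : ∃ M₂ a₀ B₁ δ₁ : ℝ, 0 < M₂ ∧ 0 < a₀ ∧ 0 ≤ B₁ ∧ 0 < δ₁ ∧
      ∀ x : MemberY d ℓ hd hL b₀ b₁ Mstar, M₂ ≤ (geo9Y x).M → ∀ α₀ : ℝ, 0 < α₀ → (geo9Y x).M * α₀ ≤ a₀ →
        ∀ U : (bg9Y 𝔸 G x).Cfg, (bg9Y 𝔸 G x).Reg335 c35 α₀ U →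
          ∃ T : Module.End ℝ (X39 𝔸 x.toKIdx → ℝ), T * L39 x.toKIdx (𝔏 x).parS (𝔏 x).Gp U = 1 ∧ L39 x.toKIdx (𝔏 x).parS (𝔏 x).Gp U * T = 1 ∧
            HasMajorant (g := toB6 (geo9Y x) (R x) (H x)) (blk39F 𝔸 x.toKIdx (bI x)) T
              (fun a a' => B₁ * (geo9Y x).len a ^ (-(4 : ℝ)) * Real.exp (-(δ₁ * (geo9Y x).dist a a')))) :
    Thm32BlkSchema 𝔸 G c35 𝔏 := by
  obtain ⟨M₂, a₀, B₁, δ₁, hM₂, ha₀, hB, hδ, hmaj⟩ := h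
  refine ⟨M₂, δ₁, a₀, max 1 (cR39 (basis39 𝔸) * Fintype.card (κ39 𝔸) * B₁ * Real.exp (2 * δ₁)), hM₂, hδ, ha₀,
    lt_of_lt_of_le one_pos (le_max_left _ _), fun x hM α₀ hα₀ hMa U hU => ?_⟩
  obtain ⟨T, hTL, hLT, hm⟩ := hmaj x hM α₀ hα₀ hMa U hU
  exact blk348At_mono (blk348At_of_hasMajorant x (𝔏 x).parS (𝔏 x).Gp U (hlev x) (hβ1 x) hB hδ.le T hTL hLT hm) (le_max_right _ _)

/-- ★ **FROM THE LEAF OF THEOREM 3.9 TO THE MAJORANT AT THE FAITHFUL PINS**: `EK x` converging INTO `Conv348Blk (𝔬39 x) B₁ δ₁ U` (`EK39OfOpsBlk(Via)`: `Iff.rfl`)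
and the pins `hblk39 : (𝔬39 x).blk = blk39F (bI x)`, `hL39 : (𝔬39 x).L = L39 (𝔏 x).parS (𝔏 x).Gp` turn `B9.Thm39Printed dd c35 geo9Y bg9Y EK` into the majorant
hypothesis of `thm32BlkSchema_of_majorants`. [cite: Balaban1985BackgroundPropagators, Thm 3.9 (3.96)–(3.99) pp.411–413 + p.413] -/
theorem majorants348_of_thm39Printed [∀ x : MemberY d ℓ hd hL b₀ b₁ Mstar, Fintype (geo9Y x).Site] {c35 : ℝ} {dd : ℕ}
    (𝔏 : ∀ x : MemberY d ℓ hd hL b₀ b₁ Mstar, CovLettersY 𝔸 x) {ι κ' : MemberY d ℓ hd hL b₀ b₁ Mstar → Type}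
    (𝔬39 : ∀ x : MemberY d ℓ hd hL b₀ b₁ Mstar, Ops39Blk (geo9Y x) (bg9Y 𝔸 G x) (X39 𝔸 x.toKIdx) (ι x) (κ' x))
    (EK : ∀ x : MemberY d ℓ hd hL b₀ b₁ Mstar, B9.RWKernelExpansion (geo9Y x) (bg9Y 𝔸 G x))
    (t39 : B9.Thm39Printed dd c35 (fun x : MemberY d ℓ hd hL b₀ b₁ Mstar => geo9Y x) (fun x => bg9Y 𝔸 G x) EK)
    {B₁ δ₁ : ℝ} (hB : 0 ≤ B₁) (hδ : 0 < δ₁)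
    (hconv : ∀ (x : MemberY d ℓ hd hL b₀ b₁ Mstar) (U : (bg9Y 𝔸 G x).Cfg), (EK x).Converges U → Conv348Blk (𝔬39 x) B₁ δ₁ U)
    {bI : ∀ x : MemberY d ℓ hd hL b₀ b₁ Mstar, FBondY x.toKIdx → IBondY x.toKIdx}
    (hblk39 : ∀ x : MemberY d ℓ hd hL b₀ b₁ Mstar, (𝔬39 x).blk = blk39F 𝔸 x.toKIdx (bI x))
    (hL39 : ∀ x : MemberY d ℓ hd hL b₀ b₁ Mstar, (𝔬39 x).L = L39 x.toKIdx (𝔏 x).parS (𝔏 x).Gp) :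
    ∃ M₂ a₀ B₁ δ₁ : ℝ, 0 < M₂ ∧ 0 < a₀ ∧ 0 ≤ B₁ ∧ 0 < δ₁ ∧
      ∀ x : MemberY d ℓ hd hL b₀ b₁ Mstar, M₂ ≤ (geo9Y x).M → ∀ α₀ : ℝ, 0 < α₀ → (geo9Y x).M * α₀ ≤ a₀ →
        ∀ U : (bg9Y 𝔸 G x).Cfg, (bg9Y 𝔸 G x).Reg335 c35 α₀ U →
          ∃ T : Module.End ℝ (X39 𝔸 x.toKIdx → ℝ), T * L39 x.toKIdx (𝔏 x).parS (𝔏 x).Gp U = 1 ∧ L39 x.toKIdx (𝔏 x).parS (𝔏 x).Gp U * T = 1 ∧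
            HasMajorant (g := toB6 (geo9Y x) 0 True) (blk39F 𝔸 x.toKIdx (bI x)) T
              (fun a a' => B₁ * (geo9Y x).len a ^ (-(4 : ℝ)) * Real.exp (-(δ₁ * (geo9Y x).dist a a'))) := by
  obtain ⟨M₂, a₀, δ₀, C, c, hM₂, ha₀, -, -, -, H39⟩ := t39
  refine ⟨M₂, a₀, B₁, δ₁, hM₂, ha₀, hB, hδ, fun x hM α₀ hα₀ hMa U hU => ?_⟩
  obtain ⟨T, hTL, hLT, hm⟩ := hconv x U (H39 x hM α₀ hα₀ hMa U hU).1
  refine ⟨T, ?_, ?_, ?_⟩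
  · rw [← hL39 x]; exact hTL
  · rw [← hL39 x]; exact hLT
  · rw [← hblk39 x]; exact hm

open scoped Matrix.Norms.L2Operator

variable {N : ℕ} {κ : Type} [Fintype κ] [DecidableEq κ]

/-- ★★★ **ROW 25 AT def-Y's v4 RECORD WITH BOTH Thm-3.1 AND Thm-3.2 INPUTS DERIVED**: (3.49) for the genuine `P = I − R(U)` from the Thm-3.7 sup majorants at
the site pins (row 18) AND the Thm-3.9 block majorant of `L39⁻¹` at the FAITHFUL block pins (rows 15–16 once pinned on `blk39F`), `hlev`, `hβ1`, `hnbr` — NO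
(3.42)∕(3.48) schema among the inputs. [cite: Balaban1985BackgroundPropagators, (3.49) p.399; Thm 3.1 ⇐ Thm 3.7 p.410; Thm 3.2 ⇐ Thm 3.9 p.413; (3.25) p.394] -/
theorem stmt349Printed_site_lettersYOfRecordV4_of_majorants37_39 (θ : Stage3Params) (Mstar : ℕ) (𝔯 : ResY N θ Mstar)
    [∀ x : MemberY θ.d₆ θ.ℓ₆ θ.hd' θ.hL' θ.b₀ θ.b₁ Mstar, Fintype (geo9Y x).Site] (b : Module.Basis κ ℝ (Matrix (Fin N) (Fin N) ℂ)) {c35 : ℝ}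
    {bI : ∀ x : MemberY θ.d₆ θ.ℓ₆ θ.hd' θ.hL' θ.b₀ θ.b₁ Mstar, FBondY x.toKIdx → IBondY x.toKIdx}
    (hlev : ∀ (x : MemberY θ.d₆ θ.ℓ₆ θ.hd' θ.hL' θ.b₀ θ.b₁ Mstar) (f : FBondY x.toKIdx), lvl x.hN x.D x.hk (bI x f) = (blkV1 x.hN x.D f).1.1)
    (hβ1 : ∀ (x : MemberY θ.d₆ θ.ℓ₆ θ.hd' θ.hL' θ.b₀ θ.b₁ Mstar) (f : FBondY x.toKIdx),
      (B6Geom246MultiLevelTorus.geomT x.D).dist (β x.hN x.D x.hk (bI x f)) (blkV1 x.hN x.D f) ≤ 1)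
    {mN : ℕ} (hnbr : ∀ (x : MemberY θ.d₆ θ.ℓ₆ θ.hd' θ.hL' θ.b₀ θ.b₁ Mstar) (y : (geo9Y x).Site), (nbr (geo9Y x) 2 y).card ≤ mN)
    {R : MemberY θ.d₆ θ.ℓ₆ θ.hd' θ.hL' θ.b₀ θ.b₁ Mstar → ℝ} {H : MemberY θ.d₆ θ.ℓ₆ θ.hd' θ.hL' θ.b₀ θ.b₁ Mstar → Prop}
    (h37 : ∃ M₂ a₀ C δ : ℝ, 0 < M₂ ∧ 0 < a₀ ∧ 0 ≤ C ∧ 0 < δ ∧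
      ∀ x : MemberY θ.d₆ θ.ℓ₆ θ.hd' θ.hL' θ.b₀ θ.b₁ Mstar, M₂ ≤ (geo9Y x).M → ∀ α₀ : ℝ, 0 < α₀ → (geo9Y x).M * α₀ ≤ a₀ →
        ∀ U : (bg9Y (Matrix (Fin N) (Fin N) ℂ) (specialUnitaryUnits (Fin N)) x).Cfg,
          (bg9Y (Matrix (Fin N) (Fin N) ℂ) (specialUnitaryUnits (Fin N)) x).Reg335 c35 α₀ U →
          HasMajorant (g := toB6 (geo9Y x) (R x) (H x)) (blkSK x.toKIdx (sIK x.toKIdx (bI x)))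
              (GcoS x.toKIdx b (bg9Y (Matrix (Fin N) (Fin N) ℂ) (specialUnitaryUnits (Fin N)) x) (fun U => U) (lettersYOfRecordV4 N θ Mstar 𝔯 x).Gp U)
              (fun a a' => C * (geo9Y x).len a ^ 2 * Real.exp (-(δ * (geo9Y x).dist a a'))) ∧
            HasMajorantHom (g := toB6 (geo9Y x) (R x) (H x)) (blkSK x.toKIdx (sIK x.toKIdx (bI x))) (blkSK x.toKIdx (sIK x.toKIdx (bI x)))
              (DcoS x.toKIdx b (bg9Y (Matrix (Fin N) (Fin N) ℂ) (specialUnitaryUnits (Fin N)) x) (fun U => U) U ∘ₗ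
                GcoS x.toKIdx b (bg9Y (Matrix (Fin N) (Fin N) ℂ) (specialUnitaryUnits (Fin N)) x) (fun U => U) (lettersYOfRecordV4 N θ Mstar 𝔯 x).Gp U)
              (fun a a' => C * (geo9Y x).len a * Real.exp (-(δ * (geo9Y x).dist a a'))))
    {R' : MemberY θ.d₆ θ.ℓ₆ θ.hd' θ.hL' θ.b₀ θ.b₁ Mstar → ℝ} {H' : MemberY θ.d₆ θ.ℓ₆ θ.hd' θ.hL' θ.b₀ θ.b₁ Mstar → Prop}
    (h39 : ∃ M₂ a₀ B₁ δ₁ : ℝ, 0 < M₂ ∧ 0 < a₀ ∧ 0 ≤ B₁ ∧ 0 < δ₁ ∧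
      ∀ x : MemberY θ.d₆ θ.ℓ₆ θ.hd' θ.hL' θ.b₀ θ.b₁ Mstar, M₂ ≤ (geo9Y x).M → ∀ α₀ : ℝ, 0 < α₀ → (geo9Y x).M * α₀ ≤ a₀ →
        ∀ U : (bg9Y (Matrix (Fin N) (Fin N) ℂ) (specialUnitaryUnits (Fin N)) x).Cfg,
          (bg9Y (Matrix (Fin N) (Fin N) ℂ) (specialUnitaryUnits (Fin N)) x).Reg335 c35 α₀ U →
          ∃ T : Module.End ℝ (X39 (Matrix (Fin N) (Fin N) ℂ) x.toKIdx → ℝ),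
            T * L39 x.toKIdx (lettersYOfRecordV4 N θ Mstar 𝔯 x).parS (lettersYOfRecordV4 N θ Mstar 𝔯 x).Gp U = 1 ∧
            L39 x.toKIdx (lettersYOfRecordV4 N θ Mstar 𝔯 x).parS (lettersYOfRecordV4 N θ Mstar 𝔯 x).Gp U * T = 1 ∧
            HasMajorant (g := toB6 (geo9Y x) (R' x) (H' x)) (blk39F (Matrix (Fin N) (Fin N) ℂ) x.toKIdx (bI x)) T
              (fun a a' => B₁ * (geo9Y x).len a ^ (-(4 : ℝ)) * Real.exp (-(δ₁ * (geo9Y x).dist a a')))) :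
    B9.Stmt349Printed (θ.d₆ + 1) c35 (geo9Y (d := θ.d₆) (ℓ := θ.ℓ₆) (hd := θ.hd') (hL := θ.hL') (b₀ := θ.b₀) (b₁ := θ.b₁) (Mstar := Mstar))
      (bg9Y (Matrix (Fin N) (Fin N) ℂ) (specialUnitaryUnits (Fin N))) (fun x => p349SiteY (Matrix (Fin N) (Fin N) ℂ) (specialUnitaryUnits (Fin N)) x
        (lettersYOfRecordV4 N θ Mstar 𝔯 x)) :=
  stmt349Printed_site_lettersYOfRecordV4_of_majorants θ Mstar 𝔯 b hlev hβ1 hnbr h37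
    (thm32BlkSchema_of_majorants (lettersYOfRecordV4 N θ Mstar 𝔯) hlev hβ1 h39)

end Family

end Literature.MathematicalPhysics.QuantumFieldTheory.Balaban1983to89.B9Ineq349SiteFromConv348

end
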